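import Summits.CriticalPhenomena.PercolationContinuityZ3.Theorems.TallClusterMassBound.Negative.FalseWithoutCriticality
import Summits.CriticalPhenomena.PercolationContinuityZ3.Theorems.PercLowPointHalfSpaceTallClusterMassBoundStubCrossoverHalfSpaceKL
import Summits.CriticalPhenomena.PercolationContinuityZ3.Theorems.PercShatteringRaceFreeSusceptibilityPowerSavingTypicalMaxBound
import Literature.Probability.Percolation.UniversalTightness
import Literature.Probability.Percolation.HalfSpaceFloorDilution
import Literature.Probability.Percolation.MeanFieldBetaFromGamma
import Literature.Probability.Percolation.CriticalContinuityProofs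
import Mathlib.Analysis.SpecialFunctions.Pow.Real

/-!
# `TallClusterMassBound` (stmt-CriticalPhenomena-0912), line `SketchIdeator4` —
# stub `stub_crossoverTransfer` (ARROW 2′, the surface crossover engine)

Second of two files (after `…StubCrossoverHalfSpaceKL.lean`). Proves exactly the registered stub
`stub_crossoverTransfer`: a subcritical surface susceptibility profile bound
`Σ_{x ∈ B_R} P_p((h,0,0) ↔ x in ℍ) ≤ C (p_c - p)^{-γ₁} (1+h)^κ` (all `p < p_c`, `h`, `R`; `1 ≤ γ₁ < 2`,
`0 ≤ κ`) gives `typicalMax PcH (halfBox r) ≤ C' r^{(3+κ)/(2-γ₁/2)}` for the induced half-space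
percolation `PcH = floorDilutedPercolation 3 p_c 1` and `Λ_r = halfBox r = B_r ∩ ℍ`.

Proof. WLOG `C > 0` (replace `C` by `max C 1`). The first file gives the KL volume tail at every root
`v ∈ ℍ`: `PcH(|C_ℍ(v)| ≥ n) ≤ K (v₀+1)^κ n^{-θ}`, `θ = 1 - γ₁/2 ≥ 0`. Since
`{|K_v ∩ Λ_r| ≥ n} ⊆ {|C_ℍ(v)| ≥ n}` (`setOf_le_clusterCapIn_subset_clusterSizeGe`) and `v₀ ≤ r` on
`Λ_r`, the tail is ROOT-UNIFORM on `Λ_r` with constant `A = max(K,1) (r+1)^κ ≥ 1`, so the landed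
first-moment bound on the typical maximum (`stub_typicalMaxBound`, Hutchcroft 2021: minimality of
`M = typicalMax`, counting of the `≥ n` roots in a maximiser's cluster, Markov) gives
`(M - 1)^{1+θ} ≤ e A |Λ_r| ≤ (27 e 2^κ max(K,1)) r^{3+κ}`; taking `(1+θ)`-th roots,
`M ≤ 1 + L^{1/(2-γ₁/2)} r^{(3+κ)/(2-γ₁/2)} ≤ (1 + L^{1/(2-γ₁/2)}) r^{(3+κ)/(2-γ₁/2)}`. No new definitions.
-/

noncomputable section

open MeasureTheory Finset Filter
open Literature.Probability.Percolation Literature.Probability.LatticeModels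
open Summit.CriticalPhenomena.PercolationContinuityZ3.Theorems.TallClusterMassBound.Negative

namespace Summit.CriticalPhenomena.PercolationContinuityZ3.Theorems.TallClusterMassBound.TightnessLine

/-- `{|K_v ∩ Λ| ≥ n} ⊆ {|C(v)| ≥ n}`: the trace of the cluster of `v` on `Λ` is a finite subset of
the cluster. [folklore] -/
theorem setOf_le_clusterCapIn_subset_clusterSizeGe (Λ : Finset V3) (v : V3) (n : ℕ) :
    {ω : BondConfig V3 | n ≤ clusterCapIn Λ ω v} ⊆ clusterSizeGe v n := by
  classical
  intro ω hω
  rw [Set.mem_setOf_eq, clusterCapIn_eq] at hω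
  rw [mem_clusterSizeGe]
  have h1 := ENat.coe_le_coe.2 hω
  refine le_trans h1 ?_
  rw [← Set.encard_coe_eq_coe_finsetCard]
  exact Set.encard_mono fun z hz => (Finset.mem_filter.1 (Finset.mem_coe.1 hz)).2

/-- **STUB 5 (ARROW 2′, ENGINE) — surface crossover transfer.** A subcritical surface
susceptibility profile bound `Σ_{x ∈ B_R} P_p((h,0,0) ↔_ℍ x) ≤ C (p_c - p)^{-γ₁} (1+h)^κ` (all
`p < p_c`, `h`, `R`; `1 ≤ γ₁ < 2`, `0 ≤ κ`) gives `typicalMax PcH (halfBox r) ≤ C' r^{(3+κ)/(2-γ₁/2)}`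
for the induced half-space percolation `PcH = floorDilutedPercolation 3 p_c 1`: the KL volume tail
`PcH(|C_ℍ(v)| ≥ n) ≤ K (v₀+1)^κ n^{-(1-γ₁/2)}` at every root `v ∈ Λ_r = halfBox r`
(`floorDiluted_real_clusterSizeGe_le_of_surfaceProfile`), `{|K_v ∩ Λ_r| ≥ n} ⊆ {|C_ℍ(v)| ≥ n}`,
and the first-moment bound on the typical maximum (`stub_typicalMaxBound`:
`(M-1)^{2-γ₁/2} ≤ e A |Λ_r|` with `A = max(K,1) (r+1)^κ`, `|Λ_r| ≤ 27 r³`). [folklore] -/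
theorem stub_crossoverTransfer :
    ∀ (γ₁ κ C : ℝ), 1 ≤ γ₁ → γ₁ < 2 → 0 ≤ κ →
      (∀ p : unitInterval, (p : ℝ) < criticalProb (zdGraph 3) (0 : V3) → ∀ h R : ℕ,
        ∑ x ∈ box 3 R, (Pp p).real (openConnIn Hs (up h) x) ≤
          C * (criticalProb (zdGraph 3) (0 : V3) - (p : ℝ)) ^ (-γ₁) * ((h : ℝ) + 1) ^ κ) →
      ∃ C' : ℝ, ∀ r : ℕ, 1 ≤ r →
        (typicalMax (floorDilutedPercolation 3 (criticalProbI 3) 1) (halfBox r) : ℝ) ≤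
          C' * (r : ℝ) ^ ((3 + κ) / (2 - γ₁ / 2)) := by
  intro γ₁ κ C _hγ1 hγ2 hκ hS
  -- WLOG `C > 0`
  have hS' : ∀ p : unitInterval, (p : ℝ) < criticalProb (zdGraph 3) (0 : V3) → ∀ h R : ℕ,
      ∑ x ∈ box 3 R, (Pp p).real (openConnIn Hs (up h) x) ≤
        max C 1 * (criticalProb (zdGraph 3) (0 : V3) - (p : ℝ)) ^ (-γ₁) * ((h : ℝ) + 1) ^ κ := by
    intro p hp h R
    refine (hS p hp h R).trans ?_
    have h1 : 0 ≤ (criticalProb (zdGraph 3) (0 : V3) - (p : ℝ)) ^ (-γ₁) :=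
      Real.rpow_nonneg (by linarith) _
    have h2 : 0 ≤ ((h : ℝ) + 1) ^ κ := Real.rpow_nonneg (by positivity) _
    have h3 : C ≤ max C 1 := le_max_left _ _
    gcongr
  obtain ⟨K, hK0, hK⟩ :=
    floorDiluted_real_clusterSizeGe_le_of_surfaceProfile γ₁ κ (max C 1) (by positivity) hS'
  set θ : ℝ := 1 - γ₁ / 2 with hθ_def
  have hθ0 : 0 ≤ θ := by rw [hθ_def]; linarith
  set a : ℝ := 2 - γ₁ / 2 with ha_def
  have ha0 : 0 < a := by rw [ha_def]; linarith
  have h1a : 1 + θ = a := by rw [hθ_def, ha_def]; ring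
  -- the constant
  set L : ℝ := Real.exp 1 * (max K 1 * (2 : ℝ) ^ κ) * 27 with hL_def
  have hL0 : 0 < L := by positivity
  refine ⟨1 + L ^ (1 / a), fun r hr => ?_⟩
  have hr0 : (0 : ℝ) < r := by exact_mod_cast hr
  have hr1 : (1 : ℝ) ≤ r := by exact_mod_cast hr
  have hΛne : (halfBox r).Nonempty := ⟨up 0, cube_subset_halfBox r (up_mem_cube (Nat.zero_le r))⟩
  -- the root-uniform tail on `Λ_r`
  set A : ℝ := max K 1 * ((r : ℝ) + 1) ^ κ with hA_def
  have hA1 : 1 ≤ A :=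
    one_le_mul_of_one_le_of_one_le (le_max_right _ _) (Real.one_le_rpow (by linarith) hκ)
  have htail : ∀ v ∈ halfBox r, ∀ n : ℕ, 1 ≤ n →
      (prodBernoulli (floorDilutedParam 3 (criticalProbI 3) 1)).real
        {ω | n ≤ clusterCapIn (halfBox r) ω v} ≤ A * (n : ℝ) ^ (-θ) := by
    intro v hv n hn
    rw [halfBox, Finset.mem_filter, mem_box] at hv
    obtain ⟨hvbox, hv0⟩ := hv
    have hvr : ((v 0 : ℤ) : ℝ) ≤ r := by exact_mod_cast (hvbox 0).2
    have hv0' : (0 : ℝ) ≤ ((v 0 : ℤ) : ℝ) := by exact_mod_cast hv0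
    have hnθ : 0 ≤ (n : ℝ) ^ (-θ) := Real.rpow_nonneg (Nat.cast_nonneg n) _
    calc (prodBernoulli (floorDilutedParam 3 (criticalProbI 3) 1)).real
          {ω | n ≤ clusterCapIn (halfBox r) ω v}
        ≤ (floorDilutedPercolation 3 (criticalProbI 3) 1).real (clusterSizeGe v n) :=
          measureReal_mono (setOf_le_clusterCapIn_subset_clusterSizeGe (halfBox r) v n)
            (measure_ne_top _ _)
      _ ≤ K * (((v 0 : ℤ) : ℝ) + 1) ^ κ * (n : ℝ) ^ (-θ) := hK v hv0 n hn
      _ ≤ max K 1 * (((r : ℝ)) + 1) ^ κ * (n : ℝ) ^ (-θ) := by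
          have h1 : K ≤ max K 1 := le_max_left _ _
          have h2 : (((v 0 : ℤ) : ℝ) + 1) ^ κ ≤ ((r : ℝ) + 1) ^ κ :=
            Real.rpow_le_rpow (by linarith) (by linarith) hκ
          have h3 : 0 ≤ ((r : ℝ) + 1) ^ κ := Real.rpow_nonneg (by linarith) _
          gcongr
      _ = A * (n : ℝ) ^ (-θ) := by rw [hA_def]
  have hmain := stub_typicalMaxBound V3 (floorDilutedParam 3 (criticalProbI 3) 1) (halfBox r) θ A
    hθ0 hA1 hΛne htail
  have hPcH : floorDilutedPercolation 3 (criticalProbI 3) 1 =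
      prodBernoulli (floorDilutedParam 3 (criticalProbI 3) 1) := rfl
  rw [hPcH]
  set M : ℕ := typicalMax (prodBernoulli (floorDilutedParam 3 (criticalProbI 3) 1)) (halfBox r)
    with hM_def
  have hM2 : 2 ≤ M := two_le_typicalMax _ hΛne
  have hM1 : (1 : ℝ) ≤ (M : ℝ) - 1 := by
    have : (2 : ℝ) ≤ M := by exact_mod_cast hM2
    linarith
  -- `|Λ_r| ≤ 27 r³`
  have hcard : ((halfBox r).card : ℝ) ≤ 27 * (r : ℝ) ^ (3 : ℕ) := by
    have h1 : (halfBox r).card ≤ (box 3 r).card := Finset.card_le_card (halfBox_subset_box r)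
    have h2 : ((halfBox r).card : ℝ) ≤ (2 * (r : ℝ) + 1) ^ 3 := by
      have : ((halfBox r).card : ℝ) ≤ ((box 3 r).card : ℝ) := by exact_mod_cast h1
      rw [card_box] at this
      push_cast at this
      exact this
    have h3 : (2 * (r : ℝ) + 1) ^ 3 ≤ (3 * (r : ℝ)) ^ 3 :=
      pow_le_pow_left₀ (by linarith) (by linarith) 3
    linarith [show (3 * (r : ℝ)) ^ 3 = 27 * (r : ℝ) ^ 3 by ring]
  -- `A ≤ max(K,1) 2^κ r^κ`
  have hA' : A ≤ max K 1 * (2 : ℝ) ^ κ * (r : ℝ) ^ κ := by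
    rw [hA_def, mul_assoc, ← Real.mul_rpow (by norm_num) hr0.le]
    exact mul_le_mul_of_nonneg_left (Real.rpow_le_rpow (by linarith) (by linarith) hκ)
      (le_trans zero_le_one (le_max_right _ _))
  have hpow : (r : ℝ) ^ (3 + κ) = (r : ℝ) ^ (3 : ℕ) * (r : ℝ) ^ κ := by
    rw [Real.rpow_add hr0]
    congr 1
    exact_mod_cast Real.rpow_natCast (r : ℝ) 3
  have hX : Real.exp 1 * A * ((halfBox r).card : ℝ) ≤ L * (r : ℝ) ^ (3 + κ) := by
    calc Real.exp 1 * A * ((halfBox r).card : ℝ)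
        ≤ Real.exp 1 * (max K 1 * (2 : ℝ) ^ κ * (r : ℝ) ^ κ) * (27 * (r : ℝ) ^ (3 : ℕ)) := by
          gcongr
      _ = L * ((r : ℝ) ^ (3 : ℕ) * (r : ℝ) ^ κ) := by rw [hL_def]; ring
      _ = L * (r : ℝ) ^ (3 + κ) := by rw [hpow]
  -- `(M - 1)^a ≤ L r^{3+κ}`, hence `M - 1 ≤ L^{1/a} r^{(3+κ)/a}`
  have h1 : ((M : ℝ) - 1) ^ a ≤ L * (r : ℝ) ^ (3 + κ) := by rw [← h1a]; exact hmain.trans hX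
  have h2 : (M : ℝ) - 1 ≤ (L * (r : ℝ) ^ (3 + κ)) ^ (1 / a) := by
    have h := Real.rpow_le_rpow (z := 1 / a) (Real.rpow_nonneg (by linarith) a) h1 (by positivity)
    rwa [← Real.rpow_mul (by linarith : (0 : ℝ) ≤ (M : ℝ) - 1), mul_one_div_cancel ha0.ne',
      Real.rpow_one] at h
  have h3 : (L * (r : ℝ) ^ (3 + κ)) ^ (1 / a) = L ^ (1 / a) * (r : ℝ) ^ ((3 + κ) / a) := by
    rw [Real.mul_rpow hL0.le (Real.rpow_nonneg hr0.le _), ← Real.rpow_mul hr0.le]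
    congr 1
    field_simp
  have h4 : (1 : ℝ) ≤ (r : ℝ) ^ ((3 + κ) / a) := Real.one_le_rpow hr1 (by positivity)
  have h5 : 0 ≤ L ^ (1 / a) := Real.rpow_nonneg hL0.le _
  rw [h3] at h2
  calc (M : ℝ) = ((M : ℝ) - 1) + 1 := by ring
    _ ≤ L ^ (1 / a) * (r : ℝ) ^ ((3 + κ) / a) + (r : ℝ) ^ ((3 + κ) / a) := add_le_add h2 h4
    _ = (1 + L ^ (1 / a)) * (r : ℝ) ^ ((3 + κ) / a) := by ring

end Summit.CriticalPhenomena.PercolationContinuityZ3.Theorems.TallClusterMassBound.TightnessLine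

end
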